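import Mathlib
import Summits.NavierStokesRegularity.NavierStokesRegularity.Theorems.WakeRatchetTailRatchetRelayMoments
import HarnessLib

/-!
# `WakeRatchet.TailRatchet` (stmt-NavierStokesRegularity-21808): the DRAIN DIRECTION of the bordered
# linearisation — `ℓ_δ = ∫ w₁·∂_δG = 8Σ_m c_m/(2^m+2) < 0`, hence the first-order law `ds/dδ = −ℓ_δ/τ < 0`
# for the time ratio of lacunary dyadic fronts

Support file for the crux `TailRatchet` (route `WakeRatchet`; MODEL lattice ODEs of Tao 2016 §1.2, §4 —
nothing in this file is a statement about the Navier–Stokes equations, and no item is closed here).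

Context (files `…RelayProfile` … `…RelayBordered`; census of stmt-21808, programme "R-lac"): the normalised
scalar front equation of the construction item `DyadicScalarFronts` is
`G_δ(b,s) = b' − (4/s²)b(t/s)² + 4sδ·b(t)b(st) = 0`, `δ = Λ⁻²`, with the exact relay solution
`(b₀,s₀) = (e^{t},2)` at `δ = 0`.  Along a solution curve `(b_δ, s_δ)` through it, differentiating in `δ`
and pairing with the adjoint mode `w₁` (Green's identity kills `L₀ḃ` on the normalised decaying class) gives
the FIRST-ORDER LAW `ṡ·τ + ℓ_δ = 0`, where `τ = ∫w₁·∂_sG` (`< 0`, `…RelayTransversality`) and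
`ℓ_δ := ∫_{(−∞,0]} w₁ · ∂_δG(b₀,2)`,  `∂_δG(b₀,2) = 4·2·b₀(t)b₀(2t) = 8e^{3t}`.
This file evaluates `ℓ_δ`, sorry-free:

* `dG_ddelta` — `∂_δ [4sδ·b₀(t)b₀(st)] |_{s=2} = 8e^{3t}` (derivative of a linear function of `δ`);
* `drain_functional_eq_tsum` — **`∫_{(−∞,0]} w₁(t)·e^{3t} dt = Σ_m c_m/(2^m + 2)`** (termwise integration);
* `drain_functional_neg` — **`Σ_m c_m/(2^m+2) < 0`** (six exact terms `−12094/298809 ≈ −0.0405` plus the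
  geometric tail `≤ 15/16384`), hence `ℓ_δ = 8·(that) < 0`;
* `first_order_time_ratio_neg` — with `τ < 0`: **`−ℓ_δ/τ < 0`**, i.e. to first order the time ratio
  DECREASES when the drain is switched on: `s_δ = 2 − (ℓ_δ/τ)... = 2 + (−ℓ_δ/τ)δ + o(δ)` with
  `−ℓ_δ/τ ≈ −2.24` — a testable prediction for numerics of lacunary dyadic fronts (`s ≈ 2 − 2.24Λ⁻²`),
  and the statement that the solution curve is transversal to BOTH the `s`- and the `δ`-axis (it can be
  parametrised by `s` as well as by `δ`, which sidesteps the derivative loss of `s ↦ b(t/s)`).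

HONEST FRAMING: elementary real analysis; first-order (formal) perturbation bookkeeping made exact as
numbers; MODEL lattice only; the construction item and the crux stay open; lacunary fronts do NOT refute
`TailRatchet` (which needs `Λ → 1`).
-/

noncomputable section

set_option linter.dupNamespace false

namespace Summit.NavierStokesRegularity.NavierStokesRegularity.Theorems

namespace WakeRatchetRelayDrainDirection

open MeasureTheory Set Filter Topology Real
open WakeRatchetRelayAdjoint WakeRatchetRelayTransversality WakeRatchetRelayMoments

/-! ## The drain direction `∂_δG = 8e^{3t}` -/

/-- `∂_δ [4·s·δ·b₀(t)b₀(st)]` at `s = 2`, `b₀ = e^{t}`, is `8e^{3t}` (the map is linear in `δ`). [folklore] -/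
theorem dG_ddelta (t : ℝ) :
    HasDerivAt (fun δ : ℝ => 4 * 2 * δ * (Real.exp t * Real.exp (2 * t))) (8 * Real.exp (3 * t)) 0 := by
  have h := ((hasDerivAt_id' (0 : ℝ)).const_mul (4 * 2)).mul_const (Real.exp t * Real.exp (2 * t))
  refine h.congr_deriv ?_
  rw [← Real.exp_add]
  ring_nf

/-! ## `∫ w₁ e^{3t}` as a series -/

/-- Termwise: `∫_{(−∞,0]} c_m e^{(2^m−1)t}e^{3t} dt = c_m/(2^m+2)`. [folklore] -/
theorem integral_term_exp_three (m : ℕ) :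
    ∫ t in Iic (0 : ℝ), (∏ i ∈ Finset.range m, ((-4 : ℝ) / (2 ^ (i + 1) - 1))) *
      Real.exp ((2 ^ m - 1) * t) * Real.exp (3 * t) =
      (∏ i ∈ Finset.range m, ((-4 : ℝ) / (2 ^ (i + 1) - 1))) * (1 / (2 ^ m + 2)) := by
  have hk : (0 : ℝ) < 2 ^ m + 2 := by positivity
  have h : (fun t : ℝ => (∏ i ∈ Finset.range m, ((-4 : ℝ) / (2 ^ (i + 1) - 1))) *
      Real.exp ((2 ^ m - 1) * t) * Real.exp (3 * t)) = fun t : ℝ =>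
      (∏ i ∈ Finset.range m, ((-4 : ℝ) / (2 ^ (i + 1) - 1))) * Real.exp ((2 ^ m + 2) * t) := by
    funext t
    have : Real.exp ((2 ^ m - 1) * t) * Real.exp (3 * t) = Real.exp ((2 ^ m + 2) * t) := by
      rw [← Real.exp_add]; congr 1; ring
    rw [mul_assoc, this]
  rw [h, integral_const_mul, integral_exp_mul_Iic_zero hk]

/-- Termwise norm: `∫‖c_m e^{(2^m−1)t}e^{3t}‖ ≤ 210·4^{−m}`. [folklore] -/
theorem integral_term_exp_three_norm_le (m : ℕ) :
    ∫ t in Iic (0 : ℝ), ‖(∏ i ∈ Finset.range m, ((-4 : ℝ) / (2 ^ (i + 1) - 1))) *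
      Real.exp ((2 ^ m - 1) * t) * Real.exp (3 * t)‖ ≤ 210 / 4 ^ m := by
  have hk : (0 : ℝ) < 2 ^ m + 2 := by positivity
  have h : (fun t : ℝ => ‖(∏ i ∈ Finset.range m, ((-4 : ℝ) / (2 ^ (i + 1) - 1))) *
      Real.exp ((2 ^ m - 1) * t) * Real.exp (3 * t)‖) = fun t : ℝ =>
      |∏ i ∈ Finset.range m, ((-4 : ℝ) / (2 ^ (i + 1) - 1))| * Real.exp ((2 ^ m + 2) * t) := by
    funext t
    have : Real.exp ((2 ^ m - 1) * t) * Real.exp (3 * t) = Real.exp ((2 ^ m + 2) * t) := by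
      rw [← Real.exp_add]; congr 1; ring
    rw [mul_assoc, this, norm_mul, Real.norm_eq_abs, Real.norm_eq_abs, abs_of_pos (Real.exp_pos _)]
  rw [h, integral_const_mul, integral_exp_mul_Iic_zero hk]
  have h1 : 1 / ((2 : ℝ) ^ m + 2) ≤ 1 := by
    rw [div_le_iff₀ hk]; linarith [one_le_two_pow_real m]
  calc |∏ i ∈ Finset.range m, ((-4 : ℝ) / (2 ^ (i + 1) - 1))| * (1 / (2 ^ m + 2))
      ≤ 210 / 4 ^ m * 1 := mul_le_mul (coeff_abs_le m) h1 (by positivity) (by positivity)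
    _ = 210 / 4 ^ m := mul_one _

/-- **`∫_{(−∞,0]} w₁(t) e^{3t} dt = Σ_m c_m/(2^m+2)`.**
[cite: Tao2016AveragedNS, §1.2 (dyadic model); cell vocabulary (adjoint mode and drain direction of the bordered linearisation at the relay profile; programme R-lac)] -/
theorem drain_functional_eq_tsum :
    ∫ t in Iic (0 : ℝ), (∑' m : ℕ, (∏ i ∈ Finset.range m, ((-4 : ℝ) / (2 ^ (i + 1) - 1))) *
        Real.exp ((2 ^ m - 1) * t)) * Real.exp (3 * t) =
      ∑' m : ℕ, (∏ i ∈ Finset.range m, ((-4 : ℝ) / (2 ^ (i + 1) - 1))) * (1 / (2 ^ m + 2)) := by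
  have hint : ∀ m : ℕ, IntegrableOn (fun t : ℝ => (∏ i ∈ Finset.range m, ((-4 : ℝ) / (2 ^ (i + 1) - 1))) *
      Real.exp ((2 ^ m - 1) * t) * Real.exp (3 * t)) (Iic 0) := by
    intro m
    have h : (fun t : ℝ => (∏ i ∈ Finset.range m, ((-4 : ℝ) / (2 ^ (i + 1) - 1))) *
        Real.exp ((2 ^ m - 1) * t) * Real.exp (3 * t)) = fun t : ℝ =>
        (∏ i ∈ Finset.range m, ((-4 : ℝ) / (2 ^ (i + 1) - 1))) * Real.exp ((2 ^ m + 2) * t) := by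
      funext t
      have : Real.exp ((2 ^ m - 1) * t) * Real.exp (3 * t) = Real.exp ((2 ^ m + 2) * t) := by
        rw [← Real.exp_add]; congr 1; ring
      rw [mul_assoc, this]
    rw [h]
    exact (integrableOn_exp_mul_Iic (by positivity : (0 : ℝ) < 2 ^ m + 2) 0).const_mul _
  have hsum : Summable (fun m : ℕ => ∫ t in Iic (0 : ℝ),
      ‖(∏ i ∈ Finset.range m, ((-4 : ℝ) / (2 ^ (i + 1) - 1))) * Real.exp ((2 ^ m - 1) * t) *
        Real.exp (3 * t)‖) :=
    Summable.of_nonneg_of_le (fun m => integral_nonneg fun t => norm_nonneg _)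
      integral_term_exp_three_norm_le summable_majorant
  have key := integral_tsum_of_summable_integral_norm hint hsum
  simp_rw [integral_term_exp_three] at key
  have hfun : (fun t : ℝ => (∑' m : ℕ, (∏ i ∈ Finset.range m, ((-4 : ℝ) / (2 ^ (i + 1) - 1))) *
        Real.exp ((2 ^ m - 1) * t)) * Real.exp (3 * t)) = fun t : ℝ => ∑' m : ℕ,
        (∏ i ∈ Finset.range m, ((-4 : ℝ) / (2 ^ (i + 1) - 1))) * Real.exp ((2 ^ m - 1) * t) *
          Real.exp (3 * t) := by
    funext t; rw [tsum_mul_right]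
  rw [hfun]
  exact key.symm

/-! ## The sign of `ℓ_δ` -/

/-- Termwise bound `|c_m/(2^m+2)| ≤ 210·8^{−m}`. [folklore] -/
theorem drain_term_abs_le (m : ℕ) :
    ‖(∏ i ∈ Finset.range m, ((-4 : ℝ) / (2 ^ (i + 1) - 1))) * (1 / (2 ^ m + 2))‖ ≤ 210 / 8 ^ m := by
  rw [Real.norm_eq_abs, abs_mul]
  have h2 : (0 : ℝ) < 2 ^ m := by positivity
  have hb0 : 0 ≤ 1 / ((2 : ℝ) ^ m + 2) := by positivity
  have hb1 : 1 / ((2 : ℝ) ^ m + 2) ≤ 1 / 2 ^ m :=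
    one_div_le_one_div_of_le h2 (by linarith)
  rw [abs_of_nonneg hb0]
  have h8 : (8 : ℝ) ^ m = 4 ^ m * 2 ^ m := by rw [← mul_pow]; norm_num
  calc |∏ i ∈ Finset.range m, ((-4 : ℝ) / (2 ^ (i + 1) - 1))| * (1 / (2 ^ m + 2))
      ≤ 210 / 4 ^ m * (1 / 2 ^ m) := mul_le_mul (coeff_abs_le m) hb1 hb0 (by positivity)
    _ = 210 / 8 ^ m := by rw [h8]; field_simp

/-- The series `Σ_m c_m/(2^m+2)` converges absolutely. [folklore] -/
theorem summable_drain_term :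
    Summable (fun m : ℕ => (∏ i ∈ Finset.range m, ((-4 : ℝ) / (2 ^ (i + 1) - 1))) * (1 / (2 ^ m + 2))) := by
  have hg : Summable (fun m : ℕ => (210 : ℝ) / 8 ^ m) := by
    have h : Summable (fun m : ℕ => (210 : ℝ) * (1 / 8) ^ m) :=
      (summable_geometric_of_lt_one (by norm_num) (by norm_num)).mul_left 210
    refine h.congr fun m => ?_
    rw [one_div, inv_pow, div_eq_mul_inv]
  exact Summable.of_norm_bounded hg drain_term_abs_le

/-- The first six terms, exactly: `Σ_{m<6} c_m/(2^m+2) = −12094/298809 ≈ −0.0405`. [folklore] -/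
theorem drain_head_six_eq :
    ∑ m ∈ Finset.range 6, (∏ i ∈ Finset.range m, ((-4 : ℝ) / (2 ^ (i + 1) - 1))) *
      (1 / (2 ^ m + 2)) = -12094 / 298809 := by
  simp only [Finset.sum_range_succ, Finset.sum_range_zero, Finset.prod_range_succ,
    Finset.prod_range_zero]
  norm_num

/-- The tail after six terms is at most `15/16384` in absolute value. [folklore] -/
theorem drain_tail_six_abs_le :
    ‖∑' m : ℕ, (∏ i ∈ Finset.range (m + 6), ((-4 : ℝ) / (2 ^ (i + 1) - 1))) *
      (1 / (2 ^ (m + 6) + 2))‖ ≤ 15 / 16384 := by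
  have hgeo : HasSum (fun m : ℕ => (210 : ℝ) / 8 ^ 6 * (1 / 8) ^ m) (210 / 8 ^ 6 * (1 - 1 / 8)⁻¹) :=
    (hasSum_geometric_of_lt_one (by norm_num) (by norm_num)).mul_left _
  have hval : (210 : ℝ) / 8 ^ 6 * (1 - 1 / 8)⁻¹ = 15 / 16384 := by norm_num
  have hfun : (fun m : ℕ => (210 : ℝ) / 8 ^ 6 * (1 / 8) ^ m) = fun m : ℕ => (210 : ℝ) / 8 ^ (m + 6) := by
    funext m
    rw [pow_add, one_div, inv_pow]
    field_simp
  rw [hval, hfun] at hgeo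
  exact tsum_of_norm_bounded hgeo fun m => drain_term_abs_le (m + 6)

/-- **`Σ_m c_m/(2^m+2) < 0`** (`≤ −12094/298809 + 15/16384 < −0.039`). [folklore] -/
theorem drain_functional_neg :
    ∑' m : ℕ, (∏ i ∈ Finset.range m, ((-4 : ℝ) / (2 ^ (i + 1) - 1))) * (1 / (2 ^ m + 2)) < 0 := by
  rw [← summable_drain_term.sum_add_tsum_nat_add 6, drain_head_six_eq]
  have htail := drain_tail_six_abs_le
  rw [Real.norm_eq_abs] at htail
  have := (abs_le.1 htail).2
  linarith

/-- **`ℓ_δ = ∫_{(−∞,0]} w₁(t)·8e^{3t} dt < 0`**: the adjoint mode does not annihilate the drain direction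
either — the solution curve of `G_δ(b,s) = 0` through the relay point is transversal to both axes.
[cite: Tao2016AveragedNS, §1.2 (dyadic model); cell vocabulary (bordered linearisation at the relay profile; programme R-lac)] -/
theorem drain_functional_integral_neg :
    ∫ t in Iic (0 : ℝ), (∑' m : ℕ, (∏ i ∈ Finset.range m, ((-4 : ℝ) / (2 ^ (i + 1) - 1))) *
        Real.exp ((2 ^ m - 1) * t)) * (8 * Real.exp (3 * t)) < 0 := by
  have hfun : (fun t : ℝ => (∑' m : ℕ, (∏ i ∈ Finset.range m, ((-4 : ℝ) / (2 ^ (i + 1) - 1))) *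
        Real.exp ((2 ^ m - 1) * t)) * (8 * Real.exp (3 * t))) = fun t : ℝ => 8 * ((∑' m : ℕ,
        (∏ i ∈ Finset.range m, ((-4 : ℝ) / (2 ^ (i + 1) - 1))) * Real.exp ((2 ^ m - 1) * t)) *
          Real.exp (3 * t)) := by
    funext t; ring
  rw [hfun, integral_const_mul, drain_functional_eq_tsum]
  have := drain_functional_neg
  linarith

/-- **FIRST-ORDER LAW FOR THE TIME RATIO: `ṡ = −ℓ_δ/τ < 0`.**  Both bordering numbers are negative
(`τ < 0`: `WakeRatchetRelayTransversality.transversality_neg`; `ℓ_δ < 0`: above), so the first-order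
coefficient `−ℓ_δ/τ` of `s_δ − 2` is NEGATIVE: switching on the drain (finite lacunary `Λ`) lowers the time
ratio of the front below the relay value `2` (numerically `s ≈ 2 − 2.24·Λ⁻²`). [folklore] -/
theorem first_order_time_ratio_neg :
    -(∫ t in Iic (0 : ℝ), (∑' m : ℕ, (∏ i ∈ Finset.range m, ((-4 : ℝ) / (2 ^ (i + 1) - 1))) *
        Real.exp ((2 ^ m - 1) * t)) * (8 * Real.exp (3 * t))) /
      (∫ t in Iic (0 : ℝ), (∑' m : ℕ, (∏ i ∈ Finset.range m, ((-4 : ℝ) / (2 ^ (i + 1) - 1))) *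
        Real.exp ((2 ^ m - 1) * t)) * ((1 + t / 2) * Real.exp t)) < 0 :=
  div_neg_of_pos_of_neg (neg_pos.2 drain_functional_integral_neg) transversality_neg

end WakeRatchetRelayDrainDirection

end Summit.NavierStokesRegularity.NavierStokesRegularity.Theorems

end
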